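import Summits.QuantumFields.BalabanUV.T4Continuum.Support.RegionBlockExtension
import Summits.QuantumFields.BalabanUV.T4Continuum.Support.RegionGaugeFixedVectorFlat

/-!
# `BalabanUV.T4Continuum.Support.RegionBlockExtensionEnergy` — NE2 (node U1a) formalisation swarm, SUPPLIER item «Δ1-COERC-ORTH» under the
# owner's sub-row `T4-U1a.S-NE2-D1-DIRICHLET°` (vector layer, W1): file 2 of the two-scale extension operator — THE ENERGY BOUND
# `Σ_ν nsq (∂_ν E g) ≤ Cext(d)·n^d·nsq (∇₁ g̃)` for the extension `E g` of `RegionBlockExtension` (exact block averages, supported in `Ω`)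
# (unit b2b-balaban-t4-ne2-formalise-leaf-09, gen 8, v1)

HONEST FRAMING (T4-DAG p. 1).  [folklore] `U = 1` lattice calculus on ONE region (any decidable set `S` of unit blocks), finite torus, `2 ≤ n`;
nothing printed is a hypothesis; NE2 (U1a) NOT proved; spine PROVED 0/9 unchanged; NOT [B9] (3.23)–(3.27) as printed; NOT infinite volume, NOT
the mass gap, NOT Clay.  HONEST DEPENDENCY (verbatim): «continuum YM on T⁴ ⇐ BetaPertH ∧ nine spine estimates (0/9 proved); BetaPertH ⇐ (D1) ∧
(D4) ∧ CAP+tail; G-an2-4 gates asym, D1 and NE2/3/4.»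

WHAT THIS FILE PROVES (0 sorry; file 1 `RegionBlockExtension` + leaf-08-g3's `sum_abs_bump_sub_le` + leaf-09-g1's `dirichlet_trial_le` + leaf-07-g5's
`RegionGaugeFixedVectorFlat.blockOf_add_unitVec` BY NAME):
 * §1 **`norm_sdiff_interp_le`**: for `x` in block `y`, `‖∂_ν ψ₀(x)‖ ≤ 6·(Bsum g y + Bsum g (y + e_ν) + ‖∇₁g̃ (y, ν)‖)` — the interpolant's
   gradient is a sum `Σ_v (G(v) − g̃ y)·∂_ν bump_v` (partition of unity), each vertex value within `Bsum` of `g̃ y` (file 1's path lemma),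
   `Σ_v |∂_ν bump_v| ≤ 3n/(n−1) ≤ 6`.
 * §2 COUNTING: `Σ_v (P g v)² ≤ 4^d·d·nsq (∇₁g̃)`, `Σ_y (Bsum g y)² ≤ 16^d·d·nsq (∇₁g̃)` (Cauchy–Schwarz + translation invariance).
 * §3 THE END **`dirichlet_extFun_le`**: `dirichlet n M (extFun n M S g) ≤ Cext d · n^d · nsq (GradOp M 1 *ᵥ ext S g)`,
   `Cext d = 216·(2d²·16^d + 1) + 8d²·576^d` — uniform in `n ≥ 2`, the torus `M` and the block set `S`.  With file 1's `QOm_blockExt`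
   (exact averages) this is the input of the two-scale estimate `RegionGradientTwoScale` (the gradient sector of `OrthSliceCoercive`).

ABSOLUTE RULE (cell, verbatim): «No internally-minted statement may enter as a cited fact. Every hypothesis is either kernel-proved in
this package or a verbatim quotation of a PUBLISHED theorem with page reference. The manuscript(s) under audit are NOT citable for
their own disputed steps — they are the thing under adjudication; programme-internal (2001/route/tribunal) claims are never citable.»
[folklore] throughout; one real constant `Cext`, no `def … : Prop`.  NOT CLAIMED: optimal constants; NE2; NE3; «not in print; our construction».
-/

noncomputable section

open scoped BigOperators ComplexConjugate Matrix
open Finset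

namespace Summit.QuantumFields.BalabanUV.T4Continuum.RegionBlockExtension

open Literature.MathematicalPhysics.QuantumFieldTheory.Balaban1983to89.B5Prop11Plancherel (Tor fine unitVec)
open Literature.MathematicalPhysics.QuantumFieldTheory.Balaban1983to89.B5Prop11Lower (nsq nsq_nonneg)
open Literature.MathematicalPhysics.QuantumFieldTheory.Balaban1983to89.B5Action121 (sdiff GradOp GradOp_mulVec sdiff_mulVec)
open Literature.MathematicalPhysics.QuantumFieldTheory.Balaban1983to89.B5Block118 (bpt)
open Literature.MathematicalPhysics.QuantumFieldTheory.Balaban1983to89.B5Blocks16 (blockOf blockOf_bpt)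
open Literature.MathematicalPhysics.QuantumFieldTheory.Balaban1983to89.B5AverageCurlStokes (sum_blocks_real)
open Summit.QuantumFields.BalabanUV.T4Continuum
open Summit.QuantumFields.BalabanUV.T4Continuum.SubtypeCompression (ext ext_apply_of ext_apply_of_not nsq_ext)
open Summit.QuantumFields.BalabanUV.T4Continuum.ScalarBlockPoincare (nsq_add_le nsq_smul)
open Summit.QuantumFields.BalabanUV.T4Continuum.ScalarAveragedPropagator (dirichlet nsq_GradOp_mulVec)
open Summit.QuantumFields.BalabanUV.T4Continuum.ScalarBlockTrialFunction (trial beta1 beta1_ge dirichlet_trial_le)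
open Summit.QuantumFields.BalabanUV.T4Continuum.DirichletMonotoneCutoff (bump sum_bump bump_mem InPatch inPatch_of_bump_ne_zero
  sum_abs_bump_sub_le pred_pos)
open Summit.QuantumFields.BalabanUV.T4Continuum.RegionGaugeFixedVectorFlat (blockOf_add_unitVec)

variable {d : ℕ} (n : ℕ) [NeZero n] (M : Fin d → ℕ) [hM : ∀ μ, NeZero (M μ)] (S : Tor M → Prop) [DecidablePred S]

/-! ## §1 The gradient of the interpolant -/

/-- the uniform vertex bound along a step: every vertex whose bump is seen at `x` or at `x + e_ν` is within
`K = Bsum g y + Bsum g (y + e_ν) + ‖∇₁g̃ (y, ν)‖` of `g̃ y`. [folklore] -/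
theorem norm_vertexVal_sub_le_of_step (g : {y // S y} → ℂ) (x : Tor (fine n M)) (ν : Fin d) (v : Tor M)
    (hv : bump n M v x ≠ 0 ∨ bump n M v (x + unitVec (fine n M) ν) ≠ 0) :
    ‖vertexVal M S g v - ext S g (blockOf n M x)‖
      ≤ Bsum M S g (blockOf n M x) + Bsum M S g (blockOf n M x + unitVec M ν)
          + ‖(GradOp M 1 *ᵥ ext S g) (blockOf n M x, ν)‖ := by
  set y := blockOf n M x with hy
  have h0 := Bsum_nonneg M S g y
  have h1 := Bsum_nonneg M S g (y + unitVec M ν)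
  have h2 := norm_nonneg ((GradOp M 1 *ᵥ ext S g) (y, ν))
  rcases hv with hb | hb
  · have hin : InPatch M v y := inPatch_of_bump_ne_zero n M hb
    have := norm_sub_vertexVal_le_Bsum M S g hin
    rw [norm_sub_rev] at this
    linarith
  · have hin := inPatch_of_bump_ne_zero n M hb
    rcases blockOf_add_unitVec n M x ν with e | e
    · rw [e] at hin
      have := norm_sub_vertexVal_le_Bsum M S g hin
      rw [norm_sub_rev] at this
      linarith
    · rw [e] at hin
      have h3 := norm_sub_vertexVal_le_Bsum M S g hin
      have h4 : ext S g (y + unitVec M ν) - ext S g y = (GradOp M 1 *ᵥ ext S g) (y, ν) := (grad_ext_apply M S g y ν).symm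
      calc ‖vertexVal M S g v - ext S g y‖
          ≤ ‖vertexVal M S g v - ext S g (y + unitVec M ν)‖ + ‖ext S g (y + unitVec M ν) - ext S g y‖ :=
            norm_sub_le_norm_sub_add_norm_sub _ _ _
        _ ≤ Bsum M S g (y + unitVec M ν) + ‖(GradOp M 1 *ᵥ ext S g) (y, ν)‖ := by
            rw [norm_sub_rev] at h3; rw [h4]; exact add_le_add h3 le_rfl
        _ ≤ _ := by linarith

/-- **THE GRADIENT BOUND OF THE INTERPOLANT**: `‖∂_ν ψ₀(x)‖ ≤ 6·(Bsum g y + Bsum g (y + e_ν) + ‖∇₁g̃ (y, ν)‖)`, `y` the block of `x`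
(`2 ≤ n`). [folklore] -/
theorem norm_sdiff_interp_le (hn : 2 ≤ n) (g : {y // S y} → ℂ) (x : Tor (fine n M)) (ν : Fin d) :
    ‖(sdiff (fine n M) (n : ℂ) ν *ᵥ interp n M S g) x‖
      ≤ 6 * (Bsum M S g (blockOf n M x) + Bsum M S g (blockOf n M x + unitVec M ν)
          + ‖(GradOp M 1 *ᵥ ext S g) (blockOf n M x, ν)‖) := by
  have hK0 : 0 ≤ Bsum M S g (blockOf n M x) + Bsum M S g (blockOf n M x + unitVec M ν)
      + ‖(GradOp M 1 *ᵥ ext S g) (blockOf n M x, ν)‖ :=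
    add_nonneg (add_nonneg (Bsum_nonneg M S g _) (Bsum_nonneg M S g _)) (norm_nonneg _)
  obtain ⟨K, hK⟩ : ∃ K : ℝ, Bsum M S g (blockOf n M x) + Bsum M S g (blockOf n M x + unitVec M ν)
      + ‖(GradOp M 1 *ᵥ ext S g) (blockOf n M x, ν)‖ = K := ⟨_, rfl⟩
  rw [hK] at hK0 ⊢
  obtain ⟨x', hx'⟩ : ∃ x' : Tor (fine n M), x + unitVec (fine n M) ν = x' := ⟨_, rfl⟩
  -- `ψ₀(x′) − ψ₀(x) = Σ_v (G v − g̃ y)(bump_v x′ − bump_v x)`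
  have hzero : ∑ v : Tor M, ext S g (blockOf n M x) * (((bump n M v x' - bump n M v x : ℝ)) : ℂ) = 0 := by
    rw [← Finset.mul_sum, ← Complex.ofReal_sum, Finset.sum_sub_distrib, sum_bump, sum_bump, sub_self, Complex.ofReal_zero, mul_zero]
  have e : interp n M S g x' - interp n M S g x
      = ∑ v : Tor M, (vertexVal M S g v - ext S g (blockOf n M x)) * (((bump n M v x' - bump n M v x : ℝ)) : ℂ) := by
    have e1 : ∑ v : Tor M, (vertexVal M S g v - ext S g (blockOf n M x)) * (((bump n M v x' - bump n M v x : ℝ)) : ℂ)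
        = ∑ v : Tor M, vertexVal M S g v * (((bump n M v x' - bump n M v x : ℝ)) : ℂ)
          - ∑ v : Tor M, ext S g (blockOf n M x) * (((bump n M v x' - bump n M v x : ℝ)) : ℂ) := by
      rw [← Finset.sum_sub_distrib]; exact Finset.sum_congr rfl fun v _ => by ring
    rw [e1, hzero, sub_zero, interp, interp, ← Finset.sum_sub_distrib]
    exact Finset.sum_congr rfl fun v _ => by push_cast; ring
  -- the sum of the bump differences
  have hδ : ∑ v : Tor M, |bump n M v x' - bump n M v x| ≤ 3 * (1 / ((n : ℝ) - 1)) := by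
    rw [← hx']; exact sum_abs_bump_sub_le n M hn x ν
  have hp := pred_pos (n := n) hn
  have hnn : (n : ℝ) * (3 * (1 / ((n : ℝ) - 1))) ≤ 6 := by
    rw [show (n : ℝ) * (3 * (1 / ((n : ℝ) - 1))) = 3 * ((n : ℝ) / ((n : ℝ) - 1)) by ring]
    have h2 : (2 : ℝ) ≤ n := by exact_mod_cast hn
    have : (n : ℝ) / ((n : ℝ) - 1) ≤ 2 := by rw [div_le_iff₀ hp]; linarith
    linarith
  rw [sdiff_mulVec, hx', norm_mul, Complex.norm_natCast, e]
  calc (n : ℝ) * ‖∑ v : Tor M, (vertexVal M S g v - ext S g (blockOf n M x)) * (((bump n M v x' - bump n M v x : ℝ)) : ℂ)‖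
      ≤ (n : ℝ) * ∑ v : Tor M, K * |bump n M v x' - bump n M v x| := by
        refine mul_le_mul_of_nonneg_left ((norm_sum_le _ _).trans (Finset.sum_le_sum fun v _ => ?_)) (Nat.cast_nonneg _)
        rw [norm_mul, Complex.norm_real, Real.norm_eq_abs]
        by_cases h0 : bump n M v x' - bump n M v x = 0
        · rw [h0, abs_zero, mul_zero, mul_zero]
        · have hv : bump n M v x ≠ 0 ∨ bump n M v x' ≠ 0 := by
            by_cases h1 : bump n M v x = 0
            · right; intro h2; exact h0 (by rw [h1, h2, sub_zero])
            · left; exact h1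
          have hb := norm_vertexVal_sub_le_of_step n M S g x ν v (by rw [hx']; exact hv)
          rw [hK] at hb
          exact mul_le_mul_of_nonneg_right hb (abs_nonneg _)
    _ = (n : ℝ) * (∑ v : Tor M, |bump n M v x' - bump n M v x|) * K := by rw [← Finset.mul_sum]; ring
    _ ≤ (n : ℝ) * (3 * (1 / ((n : ℝ) - 1))) * K := by gcongr
    _ ≤ 6 * K := mul_le_mul_of_nonneg_right hnn hK0

/-! ## §2 Counting -/

omit [DecidablePred S] in
/-- `Σ_v (P g v)² ≤ 4^d·d·nsq (∇₁g̃)`. [folklore] -/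
theorem sum_sq_P_le (g : {y // S y} → ℂ) [DecidablePred S] :
    ∑ v : Tor M, (P M S g v) ^ 2 ≤ (4 : ℝ) ^ d * d * nsq (GradOp M 1 *ᵥ ext S g) := by
  have hcard : ((Finset.univ : Finset (Fin d → Fin 2)).card : ℝ) = (2 : ℝ) ^ d := by
    rw [Finset.card_univ, Fintype.card_fun, Fintype.card_fin, Fintype.card_fin]; push_cast; ring
  have hcd : ((Finset.univ : Finset (Fin d)).card : ℝ) = d := by rw [Finset.card_univ, Fintype.card_fin]
  -- Cauchy–Schwarz twice
  have h1 : ∀ v : Tor M, (P M S g v) ^ 2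
      ≤ (2 : ℝ) ^ d * (d * ∑ τ : Fin d → Fin 2, ∑ ν : Fin d, ‖(GradOp M 1 *ᵥ ext S g) (v - upB M τ, ν)‖ ^ 2) := by
    intro v
    unfold P
    calc (∑ τ : Fin d → Fin 2, ∑ ν : Fin d, ‖(GradOp M 1 *ᵥ ext S g) (v - upB M τ, ν)‖) ^ 2
        ≤ (Finset.univ : Finset (Fin d → Fin 2)).card
            * ∑ τ : Fin d → Fin 2, (∑ ν : Fin d, ‖(GradOp M 1 *ᵥ ext S g) (v - upB M τ, ν)‖) ^ 2 := sq_sum_le_card_mul_sum_sq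
      _ ≤ (2 : ℝ) ^ d * ∑ τ : Fin d → Fin 2, ((Finset.univ : Finset (Fin d)).card
            * ∑ ν : Fin d, ‖(GradOp M 1 *ᵥ ext S g) (v - upB M τ, ν)‖ ^ 2) := by
          rw [hcard]; gcongr with τ _; exact sq_sum_le_card_mul_sum_sq
      _ = (2 : ℝ) ^ d * (d * ∑ τ : Fin d → Fin 2, ∑ ν : Fin d, ‖(GradOp M 1 *ᵥ ext S g) (v - upB M τ, ν)‖ ^ 2) := by
          rw [hcd, ← Finset.mul_sum]
  -- translation invariance of the vertex sum
  have h2 : ∑ v : Tor M, ∑ τ : Fin d → Fin 2, ∑ ν : Fin d, ‖(GradOp M 1 *ᵥ ext S g) (v - upB M τ, ν)‖ ^ 2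
      = (2 : ℝ) ^ d * nsq (GradOp M 1 *ᵥ ext S g) := by
    rw [Finset.sum_comm]
    have e : ∀ τ : Fin d → Fin 2, ∑ v : Tor M, ∑ ν : Fin d, ‖(GradOp M 1 *ᵥ ext S g) (v - upB M τ, ν)‖ ^ 2
        = nsq (GradOp M 1 *ᵥ ext S g) := by
      intro τ
      rw [nsq, Fintype.sum_prod_type]
      exact Equiv.sum_comp (Equiv.subRight (upB M τ)) (fun v => ∑ ν : Fin d, ‖(GradOp M 1 *ᵥ ext S g) (v, ν)‖ ^ 2)
    simp_rw [e]
    rw [Finset.sum_const, nsmul_eq_mul, hcard]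
  calc ∑ v : Tor M, (P M S g v) ^ 2
      ≤ ∑ v : Tor M, (2 : ℝ) ^ d * (d * ∑ τ : Fin d → Fin 2, ∑ ν : Fin d, ‖(GradOp M 1 *ᵥ ext S g) (v - upB M τ, ν)‖ ^ 2) :=
        Finset.sum_le_sum fun v _ => h1 v
    _ = (2 : ℝ) ^ d * d * ((2 : ℝ) ^ d * nsq (GradOp M 1 *ᵥ ext S g)) := by
        rw [← h2, Finset.mul_sum]; exact Finset.sum_congr rfl fun v _ => by ring
    _ = (4 : ℝ) ^ d * d * nsq (GradOp M 1 *ᵥ ext S g) := by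
        rw [show (4 : ℝ) ^ d = (2 : ℝ) ^ d * (2 : ℝ) ^ d by rw [← mul_pow]; norm_num]; ring

/-- `Σ_y (Bsum g y)² ≤ 16^d·d·nsq (∇₁g̃)`. [folklore] -/
theorem sum_sq_Bsum_le (g : {y // S y} → ℂ) :
    ∑ y : Tor M, (Bsum M S g y) ^ 2 ≤ (16 : ℝ) ^ d * d * nsq (GradOp M 1 *ᵥ ext S g) := by
  have hcard : ((Finset.univ : Finset (Fin d → Fin 2)).card : ℝ) = (2 : ℝ) ^ d := by
    rw [Finset.card_univ, Fintype.card_fun, Fintype.card_fin, Fintype.card_fin]; push_cast; ring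
  have h1 : ∀ y : Tor M, (Bsum M S g y) ^ 2 ≤ (2 : ℝ) ^ d * ∑ σ : Fin d → Fin 2, (P M S g (y + upB M σ)) ^ 2 := by
    intro y; unfold Bsum; rw [← hcard]; exact sq_sum_le_card_mul_sum_sq
  have h2 : ∑ y : Tor M, ∑ σ : Fin d → Fin 2, (P M S g (y + upB M σ)) ^ 2 = (2 : ℝ) ^ d * ∑ v : Tor M, (P M S g v) ^ 2 := by
    rw [Finset.sum_comm]
    have e : ∀ σ : Fin d → Fin 2, ∑ y : Tor M, (P M S g (y + upB M σ)) ^ 2 = ∑ v : Tor M, (P M S g v) ^ 2 := fun σ =>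
      Equiv.sum_comp (Equiv.addRight (upB M σ)) (fun v => (P M S g v) ^ 2)
    simp_rw [e]
    rw [Finset.sum_const, nsmul_eq_mul, hcard]
  calc ∑ y : Tor M, (Bsum M S g y) ^ 2 ≤ ∑ y : Tor M, (2 : ℝ) ^ d * ∑ σ : Fin d → Fin 2, (P M S g (y + upB M σ)) ^ 2 :=
        Finset.sum_le_sum fun y _ => h1 y
    _ = (2 : ℝ) ^ d * ((2 : ℝ) ^ d * ∑ v : Tor M, (P M S g v) ^ 2) := by rw [← Finset.mul_sum, h2]
    _ ≤ (2 : ℝ) ^ d * ((2 : ℝ) ^ d * ((4 : ℝ) ^ d * d * nsq (GradOp M 1 *ᵥ ext S g))) := by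
        gcongr; exact sum_sq_P_le M S g
    _ = (16 : ℝ) ^ d * d * nsq (GradOp M 1 *ᵥ ext S g) := by
        rw [show (16 : ℝ) ^ d = (2 : ℝ) ^ d * (2 : ℝ) ^ d * (4 : ℝ) ^ d by rw [← mul_pow, ← mul_pow]; norm_num]; ring

/-! ## §3 The END: the energy of the extension -/

/-- **THE EXTENSION CONSTANT** `Cext d = 216·(2d²·16^d + 1) + 8d²·576^d` (depends on `d` only). [folklore] -/
def Cext (d : ℕ) : ℝ := 216 * (2 * (d : ℝ) ^ 2 * (16 : ℝ) ^ d + 1) + 8 * (d : ℝ) ^ 2 * (576 : ℝ) ^ d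

/-- the Dirichlet form of a sum. [folklore] -/
theorem dirichlet_add_le (f g : Tor (fine n M) → ℂ) : dirichlet n M (f + g) ≤ 2 * dirichlet n M f + 2 * dirichlet n M g := by
  unfold dirichlet
  rw [Finset.mul_sum, Finset.mul_sum, ← Finset.sum_add_distrib]
  exact Finset.sum_le_sum fun ν _ => by rw [Matrix.mulVec_add]; exact nsq_add_le _ _

/-- the energy of the interpolant: `dirichlet ψ₀ ≤ 108·(2d²·16^d + 1)·n^d·nsq (∇₁g̃)`. [folklore] -/
theorem dirichlet_interp_le (hn : 2 ≤ n) (g : {y // S y} → ℂ) :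
    dirichlet n M (interp n M S g) ≤ 108 * (2 * (d : ℝ) ^ 2 * (16 : ℝ) ^ d + 1) * ((n : ℝ) ^ d * nsq (GradOp M 1 *ᵥ ext S g)) := by
  have hcardn : (Fintype.card (Fin d → Fin n) : ℝ) = (n : ℝ) ^ d := by
    rw [Fintype.card_fun, Fintype.card_fin, Fintype.card_fin]; push_cast; ring
  set N2 := nsq (GradOp M 1 *ᵥ ext S g) with hN2
  set B := fun y : Tor M => Bsum M S g y with hB
  have hBsq := sum_sq_Bsum_le M S g
  -- per direction
  have hν : ∀ ν : Fin d, nsq (sdiff (fine n M) (n : ℂ) ν *ᵥ interp n M S g)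
      ≤ 108 * (n : ℝ) ^ d * (2 * ∑ y : Tor M, (B y) ^ 2 + ∑ y : Tor M, ‖(GradOp M 1 *ᵥ ext S g) (y, ν)‖ ^ 2) := by
    intro ν
    unfold nsq
    rw [sum_blocks_real n M (fun x => ‖(sdiff (fine n M) (n : ℂ) ν *ᵥ interp n M S g) x‖ ^ 2)]
    have hpt : ∀ (y : Tor M) (j : Fin d → Fin n), ‖(sdiff (fine n M) (n : ℂ) ν *ᵥ interp n M S g) (bpt n M y j)‖ ^ 2
        ≤ 108 * ((B y) ^ 2 + (B (y + unitVec M ν)) ^ 2 + ‖(GradOp M 1 *ᵥ ext S g) (y, ν)‖ ^ 2) := by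
      intro y j
      have h := norm_sdiff_interp_le n M S hn g (bpt n M y j) ν
      rw [blockOf_bpt] at h
      have h0 := norm_nonneg ((sdiff (fine n M) (n : ℂ) ν *ᵥ interp n M S g) (bpt n M y j))
      have hb0 := Bsum_nonneg M S g y; have hb1 := Bsum_nonneg M S g (y + unitVec M ν)
      have hg0 := norm_nonneg ((GradOp M 1 *ᵥ ext S g) (y, ν))
      nlinarith [sq_nonneg (B y - B (y + unitVec M ν)), sq_nonneg (B y - ‖(GradOp M 1 *ᵥ ext S g) (y, ν)‖),
        sq_nonneg (B (y + unitVec M ν) - ‖(GradOp M 1 *ᵥ ext S g) (y, ν)‖)]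
    have hshift : ∑ y : Tor M, (B (y + unitVec M ν)) ^ 2 = ∑ y : Tor M, (B y) ^ 2 :=
      Equiv.sum_comp (Equiv.addRight (unitVec M ν)) (fun v => (B v) ^ 2)
    calc ∑ y : Tor M, ∑ j : Fin d → Fin n, ‖(sdiff (fine n M) (n : ℂ) ν *ᵥ interp n M S g) (bpt n M y j)‖ ^ 2
        ≤ ∑ y : Tor M, ∑ _j : Fin d → Fin n, 108 * ((B y) ^ 2 + (B (y + unitVec M ν)) ^ 2 + ‖(GradOp M 1 *ᵥ ext S g) (y, ν)‖ ^ 2) :=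
          Finset.sum_le_sum fun y _ => Finset.sum_le_sum fun j _ => hpt y j
      _ = (n : ℝ) ^ d * (108 * (∑ y : Tor M, (B y) ^ 2 + ∑ y : Tor M, (B (y + unitVec M ν)) ^ 2
            + ∑ y : Tor M, ‖(GradOp M 1 *ᵥ ext S g) (y, ν)‖ ^ 2)) := by
          simp only [Finset.sum_const, Finset.card_univ, nsmul_eq_mul, hcardn]
          rw [← Finset.mul_sum, ← Finset.mul_sum, Finset.sum_add_distrib, Finset.sum_add_distrib]
      _ = 108 * (n : ℝ) ^ d * (2 * ∑ y : Tor M, (B y) ^ 2 + ∑ y : Tor M, ‖(GradOp M 1 *ᵥ ext S g) (y, ν)‖ ^ 2) := by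
          rw [hshift]; ring
  have hsumν : ∑ ν : Fin d, ∑ y : Tor M, ‖(GradOp M 1 *ᵥ ext S g) (y, ν)‖ ^ 2 = N2 := by
    rw [hN2, nsq, Fintype.sum_prod_type, Finset.sum_comm]
  have hd0 : (0 : ℝ) ≤ d := Nat.cast_nonneg _
  have hn0 : (0 : ℝ) ≤ (n : ℝ) ^ d := by positivity
  have hB0 : 0 ≤ ∑ y : Tor M, (B y) ^ 2 := Finset.sum_nonneg fun _ _ => sq_nonneg _
  unfold dirichlet
  calc ∑ ν : Fin d, nsq (sdiff (fine n M) (n : ℂ) ν *ᵥ interp n M S g)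
      ≤ ∑ ν : Fin d, 108 * (n : ℝ) ^ d * (2 * ∑ y : Tor M, (B y) ^ 2 + ∑ y : Tor M, ‖(GradOp M 1 *ᵥ ext S g) (y, ν)‖ ^ 2) :=
        Finset.sum_le_sum fun ν _ => hν ν
    _ = 108 * (n : ℝ) ^ d * (2 * d * ∑ y : Tor M, (B y) ^ 2 + N2) := by
        rw [← Finset.mul_sum, Finset.sum_add_distrib, Finset.sum_const, Finset.card_univ, Fintype.card_fin, nsmul_eq_mul, hsumν]; ring
    _ ≤ 108 * (n : ℝ) ^ d * (2 * d * ((16 : ℝ) ^ d * d * N2) + N2) := by gcongr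
    _ = 108 * (2 * (d : ℝ) ^ 2 * (16 : ℝ) ^ d + 1) * ((n : ℝ) ^ d * N2) := by ring

/-- the energy of the average correction: `dirichlet (trial (ext (β₁^{−d}·r))) ≤ 4d²·576^d·n^d·nsq (∇₁g̃)`. [folklore] -/
theorem dirichlet_correction_le (hn : 2 ≤ n) (g : {y // S y} → ℂ) :
    dirichlet n M (trial n M (ext S fun y => ((((beta1 n) ^ d : ℝ) : ℂ)⁻¹) * resid n M S g y))
      ≤ 4 * (d : ℝ) ^ 2 * (576 : ℝ) ^ d * ((n : ℝ) ^ d * nsq (GradOp M 1 *ᵥ ext S g)) := by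
  set N2 := nsq (GradOp M 1 *ᵥ ext S g) with hN2
  have hβ := beta1_ge n
  have hβd : (1 / 6 : ℝ) ^ d ≤ (beta1 n) ^ d := pow_le_pow_left₀ (by norm_num) hβ.1 d
  have hβ0 : 0 < (beta1 n) ^ d := pow_pos hβ.2 d
  -- `nsq (β^{-d} r) ≤ 36^d · Σ_y Bsum² ≤ 36^d·16^d·d·nsq`
  have hr : nsq (ext S fun y => ((((beta1 n) ^ d : ℝ) : ℂ)⁻¹) * resid n M S g y) ≤ (36 : ℝ) ^ d * ((16 : ℝ) ^ d * d * N2) := by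
    rw [nsq_ext]
    have e : (fun y : {y // S y} => ((((beta1 n) ^ d : ℝ) : ℂ)⁻¹) * resid n M S g y)
        = ((((beta1 n) ^ d : ℝ) : ℂ)⁻¹) • resid n M S g := by funext y; rfl
    rw [e, nsq_smul, norm_inv, Complex.norm_real, Real.norm_of_nonneg hβ0.le]
    have h36 : ((beta1 n) ^ d)⁻¹ ^ 2 ≤ (36 : ℝ) ^ d := by
      have hinv : ((beta1 n) ^ d)⁻¹ ≤ (6 : ℝ) ^ d := by
        rw [inv_le_comm₀ hβ0 (by positivity), ← inv_pow]
        exact le_trans (by norm_num) hβd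
      calc ((beta1 n) ^ d)⁻¹ ^ 2 ≤ ((6 : ℝ) ^ d) ^ 2 := pow_le_pow_left₀ (inv_nonneg.mpr hβ0.le) hinv 2
        _ = (36 : ℝ) ^ d := by rw [← pow_mul, mul_comm, pow_mul]; norm_num
    have hres : nsq (resid n M S g) ≤ (16 : ℝ) ^ d * d * N2 := by
      calc nsq (resid n M S g) = ∑ y : {y // S y}, ‖resid n M S g y‖ ^ 2 := rfl
        _ ≤ ∑ y : {y // S y}, (Bsum M S g y) ^ 2 :=
            Finset.sum_le_sum fun y _ => pow_le_pow_left₀ (norm_nonneg _) (norm_resid_le n M S hn g y) 2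
        _ ≤ ∑ y : Tor M, (Bsum M S g y) ^ 2 := by
            rw [← Fintype.sum_subtype_add_sum_subtype S (fun y : Tor M => (Bsum M S g y) ^ 2)]
            have : 0 ≤ ∑ y : {y // ¬ S y}, (Bsum M S g y) ^ 2 := Finset.sum_nonneg fun _ _ => sq_nonneg _
            linarith
        _ ≤ (16 : ℝ) ^ d * d * N2 := sum_sq_Bsum_le M S g
    calc ((beta1 n) ^ d)⁻¹ ^ 2 * nsq (resid n M S g) ≤ (36 : ℝ) ^ d * ((16 : ℝ) ^ d * d * N2) :=
        mul_le_mul h36 hres (nsq_nonneg _) (by positivity)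
      _ = _ := rfl
  have hd0 : (0 : ℝ) ≤ d := Nat.cast_nonneg _
  calc dirichlet n M (trial n M (ext S fun y => ((((beta1 n) ^ d : ℝ) : ℂ)⁻¹) * resid n M S g y))
      ≤ 4 * d * ((n : ℝ) ^ d * nsq (ext S fun y => ((((beta1 n) ^ d : ℝ) : ℂ)⁻¹) * resid n M S g y)) := dirichlet_trial_le n M _
    _ ≤ 4 * d * ((n : ℝ) ^ d * ((36 : ℝ) ^ d * ((16 : ℝ) ^ d * d * N2))) := by gcongr
    _ = 4 * (d : ℝ) ^ 2 * (576 : ℝ) ^ d * ((n : ℝ) ^ d * N2) := by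
        rw [show (576 : ℝ) ^ d = (36 : ℝ) ^ d * (16 : ℝ) ^ d by rw [← mul_pow]; norm_num]; ring

/-- **THE END — THE ENERGY OF THE TWO-SCALE EXTENSION**: `dirichlet (extFun g) ≤ Cext d · n^d · nsq (∇₁ g̃)`, uniform in `n ≥ 2`,
the torus and the block set. [folklore] -/
theorem dirichlet_extFun_le (hn : 2 ≤ n) (g : {y // S y} → ℂ) :
    dirichlet n M (extFun n M S g) ≤ Cext d * ((n : ℝ) ^ d * nsq (GradOp M 1 *ᵥ ext S g)) := by
  have h1 := dirichlet_interp_le n M S hn g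
  have h2 := dirichlet_correction_le n M S hn g
  have h3 := dirichlet_add_le n M (interp n M S g) (trial n M (ext S fun y => ((((beta1 n) ^ d : ℝ) : ℂ)⁻¹) * resid n M S g y))
  unfold extFun Cext
  nlinarith [nsq_nonneg (GradOp M 1 *ᵥ ext S g), pow_nonneg (Nat.cast_nonneg n : (0:ℝ) ≤ n) d]

end Summit.QuantumFields.BalabanUV.T4Continuum.RegionBlockExtension

end
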